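import Summits.AnomalousDissipation.AnomalousDissipation.Theses.TaylorCertificates
import Summits.AnomalousDissipation.AnomalousDissipation.Theorems.TaylorCertificatesSteadyStatesLoudBoundedStubGpAdmissible
import Summits.AnomalousDissipation.AnomalousDissipation.Theorems.TaylorCertificatesSteadyStatesLoudBoundedStubResidualTransfer
import Summits.AnomalousDissipation.AnomalousDissipation.Theorems.TaylorCertificatesSteadyStatesLoudBoundedStubCompactnessSplit
import Summits.AnomalousDissipation.AnomalousDissipation.Theorems.TaylorCertificatesSteadyStatesLoudBoundedStubTruncationResidual
import Summits.AnomalousDissipation.AnomalousDissipation.Theorems.TaylorCertificatesSteadyStatesLoudBoundedStubDodgerAssembly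
import Literature.Analysis.FluidPDE.StatisticalSolution
import Literature.Analysis.FluidPDE.StokesTorus
import Literature.Analysis.FunctionSpaces.TorusFluidGlue
import HarnessLib.Audit

/-!
# Line `lojasiewicz-lamb-floor-ladder` for crux `TaylorCertificates.SteadyStatesLoudBounded`
# (stmt-AnomalousDissipation-13038) — crux-plan skeleton (planner, 2026-08-16)

Crux (route file, by name): `∃ f` smooth div-free mean-zero, `∃ ε₀ E ν₀`, `0 < ε₀`, `0 < ν₀`, such that for
`ν ∈ (0, ν₀)` EVERY smooth div-free mean-zero steady weak state `u` of `NS_ν(f)`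
(`∫ ⟪νΔu − (u·∇)u + f, w⟫ = 0` for all smooth div-free mean-zero `w`) has the FLOOR `ε₀ ≤ ν‖∇u‖²`
and the CEILING `∫ |u|² ≤ E`.

## The line (idea card `lojasiewicz-lamb-floor-ladder`, rung `g = 1`, triage sharpenings r1-1/2/3 applied)

Pin the Galloway–Proctor / frustrated force `f_GP = (sin 2πx₂, sin 2πx₀, sin 2πx₁)` (0-indexed; the
inline sum of three Stokes modes used verbatim by route `FrustratedForces`). The FLOOR is obtained from a
ν-FREE, PDE-free Łojasiewicz-type inequality for the Lamb/Euler map `u ↦ P(u·∇)u` ("Lamb rigidity with a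
residual cap", the card's `RigidAt f E c 1` sharpened as the panel asked):

  `RigidAt f E c δ₀`:  for every smooth div-free mean-zero `u` with `∫|u|² ≤ E` and every bound `R` of the
  Euler residual functional `w ↦ ∫⟪(u·∇)u − f, w⟫` in the dual norm over the crux's own test class
  (`|∫⟪(u·∇)u − f, w⟫| ≤ R‖∇w‖₂` for all smooth div-free mean-zero `w`), `R ≤ δ₀ ⟹ c ≤ R·‖∇u‖₂`.
  "Near-solutions of the steady forced Euler equation in the energy ball are rough, at rate `1/residual`."

* TRANSFER (`stub_residualTransfer`, provable now): at a steady state of `NS_ν(f)` the residual functional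
  IS `w ↦ ν∫⟪Δu, w⟫ = −ν∫∇u:∇w`, so `R = ν‖∇u‖₂` is an admissible bound (torus IBP + Cauchy–Schwarz); either
  `R ≤ δ₀` and rigidity gives `ν‖∇u‖² = R‖∇u‖ ≥ c`, or `R > δ₀` and `ν‖∇u‖² = R²/ν > δ₀²/ν`. Hence
  `RigidAt f E c δ₀ ⟹ ν‖∇u‖² ≥ min c (δ₀²/ν)` for every steady state of energy `≤ E` — the `g = 1` rung of the
  card's `GradedTransfer` (rungs `g > 1` give floors `→ 0` as `ν → 0`: Disproof-side tightness, not stubs).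
* COMPACTNESS SPLIT (`stub_compactnessSplit`, provable now): `RigidAt f E c δ₀` for SOME `c, δ₀ > 0` follows
  from the absence of its only two enemies — (Q) a finite-enstrophy weak steady EULER state of `f` in the
  closed `E`-ball (`u ∈ V`, `Torus.IsSteadyWeakSolution 0 f u`), and (D) an ONSAGER DODGER: smooth admissible
  `u_n`, `∫|u_n|² ≤ E`, residual bounds `R_n → 0` with VIRTUAL DISSIPATION `R_n‖∇u_n‖ → 0` and `‖∇u_n‖ → ∞`.
  (Negating `∃ c δ₀` gives a bad sequence; bounded enstrophy along a subsequence + Rellich in `H`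
  (`Torus.isCompact_setOf_eGradNormSq_le`) + continuity of the inertial pairing give a limit in `V` solving
  steady Euler weakly, i.e. enemy (Q); otherwise the sequence is enemy (D).)
* DODGERS FROM QUIET POINTS (`dodgerOfQuietPoint`, PROVED from stubs S4a `stub_truncationResidual` + S4b `stub_dodgerAssembly`): a standing flow `U ∈ V` of `f` with
  `‖U‖² < E`, Fourier-truncated and dressed with a vanishing high-frequency shear wiggle, IS an Onsager dodger
  at level `E` — so enemy (Q) is a special case of enemy (D) one energy level up, and the old stand-alone bet
  "no `V`-standing flow of `f_GP`" becomes the COROLLARY `gp_noQuietEulerPoint` (it still implies the route's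
  crux #6 `SmoothEulerCoerciveForce` with witness `f_GP` on smooth fields).
* THE BETS, pinned on `f_GP`: `stub_gpNoOnsagerDodger` (HARDEST; the ONE floor bet: the steady, PDE-free zeroth
  law for `f_GP` — its killers are exactly standing flows of `f_GP` in `V` or of Onsager-SUPERcritical
  regularity `C^σ`, `σ > 1/3`, beyond every stationary h-principle in print, all `L^∞`), and the CEILING half of
  the crux at `f_GP`, `stub_gpSteadyCeiling` (held; shared with the ceiling lines of this crux and with
  `FrustratedForces.GPSteadySubGrashof`, which it implies).
* `stub_gpAdmissible`: `f_GP` is smooth, div-free, mean-zero (character-for-character the body of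
  `FrustratedForces.GPForceAdmissible`, stmt-AnomalousDissipation-2981; provable now).

Composition `SteadyStatesLoudBounded_of`: `E, ν₁` from the ceiling S6; enemy (Q) at level `E` from S4 + S5 at
level `E + 1`; `(c, δ₀)` from the split S3 at `E`; `ν₀ = min ν₁ 1`, `ε₀ = min c δ₀²` (for `ν < 1`,
`δ₀²/ν ≥ δ₀²`); floor from S2.

Disproof.lean (cdisprove v5, evidence 2026-08-15T23:07Z; read through its evidence notes — the file itself
is not mounted on planner boxes): `cruxWithoutNuPos_false` / `cruxWithoutNuLt_false` honoured — `0 < ν` is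
used in `stub_residualTransfer` (division by `ν`), `ν < ν₀ ≤ 1` in the composition, and RigidAt carries the
residual cap `δ₀` so that the small laminar-like states `u = s·v, s → 0` (residual `→ ‖f‖_{Ḣ⁻¹} > δ₀`) impose
nothing (triage r1-2/r1-3 vacuity objection); `not_body_fin_two`, `not_body_twoHalf_planar`,
`not_body_unidirectional`, `not_body_neg_laplacian_of_euler`: `f_GP` is genuinely three-dimensional, not
`x₃`-invariant, not unidirectional, and NOT a steady Euler flow (`P(f_GP·∇)f_GP ≠ 0`: `(f·∇)f =
(sin 2πx₁ cos 2πx₂, sin 2πx₂ cos 2πx₀, sin 2πx₀ cos 2πx₁)·2π` has non-zero curl of its curl-free test), so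
none of the refuted force classes is instantiated; `energy_floor_of_floor` / `body_smul_iff` are consistent
with the stubs (only the shape of `f` matters; we fix amplitude 1). No `-- Targets` stub of Disproof is reused.
-/

noncomputable section

set_option linter.dupNamespace false

namespace Summit.AnomalousDissipation.AnomalousDissipation.Cruxes.SteadyStatesLoudBounded.LojasiewiczLambFloorLadder

open MeasureTheory Filter Topology UnitAddTorus
open scoped InnerProductSpace ENNReal
open Literature.Analysis.FunctionSpaces Literature.Analysis.FluidPDE
open Summit.AnomalousDissipation.AnomalousDissipation.Theses.TaylorCertificates

/-! ## The stubs (S1–S4 provable now; S5–S6 open, pinned on the Galloway–Proctor force) — tree vocabulary only -/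

/-- **S1 `stub_gpAdmissible`** — the Galloway–Proctor force
`f_GP(x) = sin(2πx₂)e₀ + sin(2πx₀)e₁ + sin(2πx₁)e₂` (inline sum of three Stokes modes
`Torus.stokesMode k a false = sin(2πk·x) a`) is smooth, divergence free and mean zero. Character-for-character
the body of `FrustratedForces.GPForceAdmissible` (stmt-AnomalousDissipation-2981): smooth as a real
trigonometric polynomial; `∂ᵢ` of component `i` vanishes (component `i` depends on `x_{i-1}` only,
`k · a = 0`); `∫ sin(2π x_j) = 0`. Provable now, size S–M (~100–200 lines). -/
theorem stub_gpAdmissible :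
    Torus.IsSmooth (fun x : UnitAddTorus (Fin 3) =>
        (Torus.stokesMode (Pi.single (2 : Fin 3) (1 : ℤ)) (EuclideanSpace.single (0 : Fin 3) (1 : ℝ)) false x +
          Torus.stokesMode (Pi.single (0 : Fin 3) (1 : ℤ)) (EuclideanSpace.single (1 : Fin 3) (1 : ℝ)) false x +
          Torus.stokesMode (Pi.single (1 : Fin 3) (1 : ℤ)) (EuclideanSpace.single (2 : Fin 3) (1 : ℝ)) false x :
          EuclideanSpace ℝ (Fin 3))) ∧
      Torus.IsDivFree (fun x : UnitAddTorus (Fin 3) =>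
        (Torus.stokesMode (Pi.single (2 : Fin 3) (1 : ℤ)) (EuclideanSpace.single (0 : Fin 3) (1 : ℝ)) false x +
          Torus.stokesMode (Pi.single (0 : Fin 3) (1 : ℤ)) (EuclideanSpace.single (1 : Fin 3) (1 : ℝ)) false x +
          Torus.stokesMode (Pi.single (1 : Fin 3) (1 : ℤ)) (EuclideanSpace.single (2 : Fin 3) (1 : ℝ)) false x :
          EuclideanSpace ℝ (Fin 3))) ∧
      Torus.HasZeroMean (fun x : UnitAddTorus (Fin 3) =>
        (Torus.stokesMode (Pi.single (2 : Fin 3) (1 : ℤ)) (EuclideanSpace.single (0 : Fin 3) (1 : ℝ)) false x +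
          Torus.stokesMode (Pi.single (0 : Fin 3) (1 : ℤ)) (EuclideanSpace.single (1 : Fin 3) (1 : ℝ)) false x +
          Torus.stokesMode (Pi.single (1 : Fin 3) (1 : ℤ)) (EuclideanSpace.single (2 : Fin 3) (1 : ℝ)) false x :
          EuclideanSpace ℝ (Fin 3))) :=
  _root_.Summit.AnomalousDissipation.AnomalousDissipation.Theorems.SteadyStatesLoudBounded.GpAdmissible.stub_gpAdmissible

/-- **S2 `stub_residualTransfer`** — THE `g = 1` RUNG OF THE GRADED TRANSFER, WITH THE RESIDUAL CAP
(`RigidAt f E c δ₀ ⟹` FLOOR `min c (δ₀²/ν)` for every steady state of `NS_ν(f)` of energy `≤ E`).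
Why true: from the steady identity `∫⟪νΔu − (u·∇)u + f, w⟫ = 0` (all three summands integrable: smooth
fields on the compact torus), `∫⟪(u·∇)u − f, w⟫ = ν∫⟪Δu, w⟫ = −ν ∑ᵢ∫⟪∂ᵢu, ∂ᵢw⟫`
(`integral_inner_laplacian_eq_neg_sum`, Green on `T³`), so by Cauchy–Schwarz in `L²(T³; ℝ^{3×3})`
`|∫⟪(u·∇)u − f, w⟫| ≤ ν‖∇u‖₂‖∇w‖₂` with `‖∇v‖₂² = Torus.gradNormSq v = ∫∑ᵢ‖∂ᵢv‖²`: `R := ν√(gradNormSq u) ≥ 0`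
is an admissible residual bound. If `R ≤ δ₀`, rigidity gives `c ≤ R√(gradNormSq u) = ν·gradNormSq u`; if
`R > δ₀ (> 0)`, then `ν·gradNormSq u = R²/ν > δ₀²/ν`. Uses `0 < ν`, `0 < δ₀`; no sign needed on `c`, `E`.
Size M (IBP is in tree; the Cauchy–Schwarz/`Real.sqrt` bookkeeping for the Frobenius sum is the work). -/
theorem stub_residualTransfer :
    ∀ (ν E c δ₀ : ℝ) (f : UnitAddTorus (Fin 3) → EuclideanSpace ℝ (Fin 3)),
      0 < ν → 0 < δ₀ → Torus.IsSmooth f →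
      (∀ u : UnitAddTorus (Fin 3) → EuclideanSpace ℝ (Fin 3),
        Torus.IsSmooth u → Torus.IsDivFree u → Torus.HasZeroMean u → ∫ x, ‖u x‖ ^ 2 ≤ E →
        ∀ R : ℝ, 0 ≤ R →
          (∀ w : UnitAddTorus (Fin 3) → EuclideanSpace ℝ (Fin 3),
            Torus.IsSmooth w → Torus.IsDivFree w → Torus.HasZeroMean w →
            |∫ x, inner ℝ (Torus.convect u u x - f x) (w x)| ≤ R * Real.sqrt (Torus.gradNormSq w)) →
          R ≤ δ₀ → c ≤ R * Real.sqrt (Torus.gradNormSq u)) →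
      ∀ u : UnitAddTorus (Fin 3) → EuclideanSpace ℝ (Fin 3),
        Torus.IsSmooth u → Torus.IsDivFree u → Torus.HasZeroMean u →
        (∀ w : UnitAddTorus (Fin 3) → EuclideanSpace ℝ (Fin 3),
          Torus.IsSmooth w → Torus.IsDivFree w → Torus.HasZeroMean w →
          ∫ x, inner ℝ (ν • Torus.laplacian u x - Torus.convect u u x + f x) (w x) = 0) →
        ∫ x, ‖u x‖ ^ 2 ≤ E →
        min c (δ₀ ^ 2 / ν) ≤ ν * Torus.gradNormSq u :=
  _root_.Summit.AnomalousDissipation.AnomalousDissipation.Theorems.SteadyStatesLoudBounded.ResidualTransfer.stub_residualTransfer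

/-- **S3 `stub_compactnessSplit`** — RIGIDITY FROM THE ABSENCE OF ITS TWO ENEMIES (quiet `V`-Euler states
in the ball; Onsager dodgers). For smooth `f` and an energy level `E`: if (Q) every finite-enstrophy weak
steady Euler state of `f` (`u ∈ V`, `Torus.IsSteadyWeakSolution 0 f u`, i.e. `(f,w) + ∫(u⊗u):∇w = 0` on
`𝒱`) has `‖u‖² > E`, and (D) every bad sequence (smooth admissible `u_n`, `∫|u_n|² ≤ E`, residual bounds
`R_n ≥ 0` with `R_n → 0` and virtual dissipation `R_n√(gradNormSq u_n) → 0`) has NON-divergent enstrophy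
(`∃ B`, `gradNormSq u_n ≤ B` for infinitely many `n`), then `RigidAt f E c δ₀` holds for some `c, δ₀ > 0`.
Why true (contrapositive + compactness, all tools in tree): if no `(c, δ₀)` works, choosing
`c = δ₀ = 1/(n+1)` produces a bad sequence as in (D); (D) gives `B` and a subsequence with
`gradNormSq ≤ B`; lift to `H` (`MemLp.toLp`, `Torus.smoothSolenoidal_subset_energySpace`), where
`eGradNormSq = ofReal gradNormSq ≤ ofReal B` (`Torus.gradNormSq_eq_toReal_eGradNormSq_holds`,
`eGradNormSq_congr_ae`), so the lifts lie in the norm-compact set `{eGradNormSq ≤ B}`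
(`Torus.isCompact_setOf_eGradNormSq_le`): a further subsequence converges in `H` to `v` with `‖v‖² ≤ E`,
`v ∈ V` (`Torus.lowerSemicontinuous_eGradNormSq_coe`, `memSobolev_one_complexify_of_eGradNormSq_ne_top`), and
for each test `w ∈ 𝒱`: `nsGeneratorPairing 0 f v w = (f,w) + inertialPairing v w = lim [(f,w) +
inertialPairing uₙ w]` (`continuous_inertialPairing_coe`) `= lim −∫⟪(uₙ·∇)uₙ − f, w⟫`
(`Torus.integral_inner_convect_eq_neg`: `∫⟪(u·∇)u, w⟫ = −∫⟪u,(u·∇)w⟫ = −∫⟪Dw·u, u⟫`) `= 0`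
(`|·| ≤ Rₙ√(gradNormSq w) → 0`). So `v` is enemy (Q) inside the closed ball — contradiction. Size M–L. -/
theorem stub_compactnessSplit :
    ∀ (f : UnitAddTorus (Fin 3) → EuclideanSpace ℝ (Fin 3)) (E : ℝ), Torus.IsSmooth f →
      (∀ u : Torus.energySpace (Fin 3),
        (u : Lp (EuclideanSpace ℝ (Fin 3)) 2 (volume : Measure (UnitAddTorus (Fin 3)))) ∈ Torus.energySpaceV (Fin 3) →
        Torus.IsSteadyWeakSolution 0 f u → E < ‖u‖ ^ 2) →
      (∀ (u : ℕ → UnitAddTorus (Fin 3) → EuclideanSpace ℝ (Fin 3)) (R : ℕ → ℝ),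
        (∀ n : ℕ, Torus.IsSmooth (u n) ∧ Torus.IsDivFree (u n) ∧ Torus.HasZeroMean (u n) ∧
          ∫ x, ‖u n x‖ ^ 2 ≤ E ∧ 0 ≤ R n ∧
          ∀ w : UnitAddTorus (Fin 3) → EuclideanSpace ℝ (Fin 3),
            Torus.IsSmooth w → Torus.IsDivFree w → Torus.HasZeroMean w →
            |∫ x, inner ℝ (Torus.convect (u n) (u n) x - f x) (w x)| ≤ R n * Real.sqrt (Torus.gradNormSq w)) →
        Tendsto R atTop (𝓝 0) →
        Tendsto (fun n => R n * Real.sqrt (Torus.gradNormSq (u n))) atTop (𝓝 0) →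
        ∃ B : ℝ, ∀ N : ℕ, ∃ n : ℕ, N ≤ n ∧ Torus.gradNormSq (u n) ≤ B) →
      ∃ c δ₀ : ℝ, 0 < c ∧ 0 < δ₀ ∧
        ∀ u : UnitAddTorus (Fin 3) → EuclideanSpace ℝ (Fin 3),
          Torus.IsSmooth u → Torus.IsDivFree u → Torus.HasZeroMean u → ∫ x, ‖u x‖ ^ 2 ≤ E →
          ∀ R : ℝ, 0 ≤ R →
            (∀ w : UnitAddTorus (Fin 3) → EuclideanSpace ℝ (Fin 3),
              Torus.IsSmooth w → Torus.IsDivFree w → Torus.HasZeroMean w →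
              |∫ x, inner ℝ (Torus.convect u u x - f x) (w x)| ≤ R * Real.sqrt (Torus.gradNormSq w)) →
            R ≤ δ₀ → c ≤ R * Real.sqrt (Torus.gradNormSq u) :=
  _root_.Summit.AnomalousDissipation.AnomalousDissipation.Theorems.SteadyStatesLoudBounded.CompactnessSplit.stub_compactnessSplit

/-- **S4 = S4a + S4b (was `stub_dodgerOfQuietPoint`)** — A STANDING FLOW OF FINITE ENSTROPHY SPAWNS ONSAGER DODGERS AT EVERY
HIGHER ENERGY LEVEL (provable now; general `f`). If bad sequences of `f` at level `E` have non-divergent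
enstrophy (the hypothesis block = `NoOnsagerDodger f E`, verbatim the conclusion shape of S5), then every
`u ∈ V` solving steady Euler weakly with force `f` (`Torus.IsSteadyWeakSolution 0 f u`: `(f,w) + ∫(u⊗u):∇w = 0`
on `𝒱`) has `E ≤ ‖u‖²`. Why true (contrapositive, explicit construction): let `U ∈ V` stand with `‖U‖² < E`.
Fourier-truncate, `U_N := P_{≤N}U` (real trigonometric polynomial: smooth, div-free since `k·Û(k) = 0`
(`Torus.mem_energySpace_iff`), mean-zero; `U_N → U` in `H¹`, hence in `L⁴` by Sobolev on `T³`, so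
`R(U_N) := ‖U⊗U − U_N⊗U_N‖_{L²} → 0`, and `|∫⟪(U_N·∇)U_N − f, w⟫| = |∫(U⊗U − U_N⊗U_N):∇w| ≤ R(U_N)‖∇w‖₂`
using the standing identity `(f,w) = −∫(U⊗U):∇w`). Add a WIGGLE `a_n W_M`, `W_M = √2 sin(2πM x₀) e₁`
(admissible, `‖W_M‖₂ = 1`, `‖W_M‖_∞ = √2`, `‖∇W_M‖₂ = 2πM`, `(W_M·∇)W_M = 0`, Fourier-orthogonal to `U_N` for
`M > N`): `u_n := U_{N_n} + a_n W_{M_n}` is admissible with `∫|u_n|² = ‖U_{N_n}‖² + a_n² ≤ E` for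
`a_n² ≤ E − ‖U‖²`, residual bound `R_n := R(U_{N_n}) + 2√2 a_n‖U‖₂` (cross term
`|∫(U_N⊗W + W⊗U_N):∇w| ≤ 2‖U_N‖₂‖W‖_∞‖∇w‖₂`), enstrophy `gradNormSq u_n = gradNormSq U_{N_n} + 4π²a_n²M_n² → ∞`
and virtual dissipation `R_n√(gradNormSq u_n) ≤ R_n(‖∇U‖₂ + 2πa_nM_n) → 0` for the choice
`r_n := R(U_{N_n}) + 1/(n+1)`, `a_n := min(√((E−‖U‖²)/2), r_n, 1/(n+1))`, `M_n := max(N_n+1, ⌈a_n⁻¹ r_n^{-1/2}⌉)`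
(`a_nM_n ≥ r_n^{-1/2} → ∞`, `R_n a_n M_n ≲ r_n + r_n^{1/2} → 0`). This bad sequence has divergent enstrophy —
contradiction. COROLLARY (below, sorry-free given the stubs): `gp_noQuietEulerPoint` — `f_GP` has NO standing
flow in `V` at all (apply at `E = ‖u‖² + 1` with S5), i.e. the Dirac slice of forced-Euler coercivity of `f_GP`
(cf. `ForcedSmallScales.CyclicForceCoercive`, same force up to relabelling) and, on smooth `u`, the `∀ v` clause
of the route's crux #6 `SmoothEulerCoerciveForce` WITH WITNESS `f_GP`. Size M–L. Leans on: Fourier truncation on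
`H` (`Torus.fourierTruncate`/Galerkin API, `EnergySpaceTorusGalerkinProofs`), `Torus.isSmooth_realTrigPoly`,
`Torus.isDivFree_realTrigPoly_singleton`, Sobolev `H¹ ⊂ L⁴` on `T^d`, `d ≤ 4` (as in
`Temam1979_steadyWeakSolution_energy_eq_holds`), `Torus.integral_inner_convect_eq_neg`.
RESHAPED by the lead (2026-08-16, before wave 1): split at the skeleton level into the analytic estimate
S4a `stub_truncationResidual` and the algebraic assembly S4b `stub_dodgerAssembly`; `dodgerOfQuietPoint` is now
PROVED from the two (ten lines of logic, below the stubs). -/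
theorem stub_truncationResidual :
    ∀ (f : UnitAddTorus (Fin 3) → EuclideanSpace ℝ (Fin 3)) (U : Torus.energySpace (Fin 3)), Torus.IsSmooth f →
      (U : Lp (EuclideanSpace ℝ (Fin 3)) 2 (volume : Measure (UnitAddTorus (Fin 3)))) ∈ Torus.energySpaceV (Fin 3) →
      Torus.IsSteadyWeakSolution 0 f U →
      ∃ r : ℕ → ℝ, (∀ N : ℕ, 0 ≤ r N) ∧ Tendsto r atTop (𝓝 0) ∧
        ∀ (N : ℕ) (w : UnitAddTorus (Fin 3) → EuclideanSpace ℝ (Fin 3)),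
          Torus.IsSmooth w → Torus.IsDivFree w → Torus.HasZeroMean w →
          |∫ x, inner ℝ (Torus.convect
              (Torus.fourierTruncate N
                ((U : Lp (EuclideanSpace ℝ (Fin 3)) 2 (volume : Measure (UnitAddTorus (Fin 3)))) :
                  UnitAddTorus (Fin 3) → EuclideanSpace ℝ (Fin 3)))
              (Torus.fourierTruncate N
                ((U : Lp (EuclideanSpace ℝ (Fin 3)) 2 (volume : Measure (UnitAddTorus (Fin 3)))) :
                  UnitAddTorus (Fin 3) → EuclideanSpace ℝ (Fin 3))) x - f x) (w x)| ≤
            r N * Real.sqrt (Torus.gradNormSq w) :=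
  _root_.Summit.AnomalousDissipation.AnomalousDissipation.Theorems.SteadyStatesLoudBounded.TruncationResidual.stub_truncationResidual

/-- **S4b `stub_dodgerAssembly`** — THE DODGER BUILT FROM TRUNCATIONS PLUS A SHEAR WIGGLE (provable now; pure
trigonometric-polynomial algebra, no Sobolev embedding). Given `U ∈ V` with `‖U‖² < E` and residual bounds
`r_N → 0` for its Fourier truncations `U_N := fourierTruncate N U` (the conclusion of S4a, taken as a hypothesis),
there is a bad sequence at level `E` with DIVERGENT enstrophy: `u_n := U_{N_n} + a_n • W_{M_n}` with the wiggle
`W_M x := Torus.stokesMode (Pi.single 0 (M : ℤ)) (EuclideanSpace.single 1 (Real.sqrt 2)) false x = √2 sin(2πM x₀) e₁`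
(smooth, div-free, mean-zero, `∫|W_M|² = 1`, `‖W_M x‖ ≤ √2`, `gradNormSq W_M = 4π²M²`, `(W_M·∇)W_M = 0` since
`W_M` depends on `x₀` only and points along `e₁`; Fourier-orthogonal — values AND gradients — to `U_N` when
`M > N`, as `freqBall N = {|k|² ≤ N²}`). Bookkeeping: `U_N` admissible (`isSmooth_/isDivFree_/hasZeroMean_
fourierTruncate…`), `∫|U_N|² ≤ ‖U‖²` (`integral_norm_sq_fourierTruncate_le`), `gradNormSq U_N ≤ G_U :=
(eGradNormSq U).toReal < ∞` (`eGradNormSq_fourierTruncate_le`, `U ∈ V`); energy `∫|u_n|² = ∫|U_N|² + a_n² ≤ E`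
for `a_n² ≤ E − ‖U‖²`; residual `R_n := r_{N_n} + 2√6·a_n·‖U‖` (cross terms by antisymmetry
`∫⟪(U_N·∇)W + (W·∇)U_N, w⟫ = −∫⟪W,(U_N·∇)w⟫ − ∫⟪U_N,(W·∇)w⟫`, `‖W‖_∞ ≤ √2`, `‖Dw‖₂ ≤ √3·√(gradNormSq w)`; the
`a_n²` term vanishes identically); enstrophy `4π²a_n²M_n² ≤ gradNormSq u_n ≤ G_U + 4π²a_n²M_n²`. Parameters
(`m := n+1`): `N_m` with `r_{N_m} ≤ 1/m²`, `M_m := max (N_m+1) m³`, `a_m := min (m/M_m) √((E−‖U‖²)/2)`: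
then `R_m ≤ (1+2√6‖U‖)/m² → 0`, `a_m M_m ≥ min(m, c₀m³) → ∞`, `R_m √(gradNormSq u_m) ≤ (C/m²)(√G_U + 2πm) → 0`. -/
theorem stub_dodgerAssembly :
    ∀ (f : UnitAddTorus (Fin 3) → EuclideanSpace ℝ (Fin 3)) (E : ℝ) (U : Torus.energySpace (Fin 3)), Torus.IsSmooth f →
      (U : Lp (EuclideanSpace ℝ (Fin 3)) 2 (volume : Measure (UnitAddTorus (Fin 3)))) ∈ Torus.energySpaceV (Fin 3) →
      ‖U‖ ^ 2 < E →
      (∃ r : ℕ → ℝ, (∀ N : ℕ, 0 ≤ r N) ∧ Tendsto r atTop (𝓝 0) ∧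
        ∀ (N : ℕ) (w : UnitAddTorus (Fin 3) → EuclideanSpace ℝ (Fin 3)),
          Torus.IsSmooth w → Torus.IsDivFree w → Torus.HasZeroMean w →
          |∫ x, inner ℝ (Torus.convect
              (Torus.fourierTruncate N
                ((U : Lp (EuclideanSpace ℝ (Fin 3)) 2 (volume : Measure (UnitAddTorus (Fin 3)))) :
                  UnitAddTorus (Fin 3) → EuclideanSpace ℝ (Fin 3)))
              (Torus.fourierTruncate N
                ((U : Lp (EuclideanSpace ℝ (Fin 3)) 2 (volume : Measure (UnitAddTorus (Fin 3)))) :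
                  UnitAddTorus (Fin 3) → EuclideanSpace ℝ (Fin 3))) x - f x) (w x)| ≤
            r N * Real.sqrt (Torus.gradNormSq w)) →
      ∃ (u : ℕ → UnitAddTorus (Fin 3) → EuclideanSpace ℝ (Fin 3)) (R : ℕ → ℝ),
        (∀ n : ℕ, Torus.IsSmooth (u n) ∧ Torus.IsDivFree (u n) ∧ Torus.HasZeroMean (u n) ∧
          ∫ x, ‖u n x‖ ^ 2 ≤ E ∧ 0 ≤ R n ∧
          ∀ w : UnitAddTorus (Fin 3) → EuclideanSpace ℝ (Fin 3),
            Torus.IsSmooth w → Torus.IsDivFree w → Torus.HasZeroMean w →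
            |∫ x, inner ℝ (Torus.convect (u n) (u n) x - f x) (w x)| ≤ R n * Real.sqrt (Torus.gradNormSq w)) ∧
        Tendsto R atTop (𝓝 0) ∧
        Tendsto (fun n => R n * Real.sqrt (Torus.gradNormSq (u n))) atTop (𝓝 0) ∧
        ∀ B : ℝ, ∃ N : ℕ, ∀ n : ℕ, N ≤ n → B < Torus.gradNormSq (u n) :=
  _root_.Summit.AnomalousDissipation.AnomalousDissipation.Theorems.SteadyStatesLoudBounded.DodgerAssembly.stub_dodgerAssembly

/-- **S4 (now a theorem) `dodgerOfQuietPoint`** — the registered shape of the old stub, PROVED from S4a + S4b: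
no Onsager dodgers at level `E` ⟹ every standing flow `u ∈ V` of `f` has `E ≤ ‖u‖²` (else S4a + S4b produce a bad
sequence with divergent enstrophy, contradicting the hypothesis). -/
theorem dodgerOfQuietPoint :
    ∀ (f : UnitAddTorus (Fin 3) → EuclideanSpace ℝ (Fin 3)) (E : ℝ), Torus.IsSmooth f →
      (∀ (u : ℕ → UnitAddTorus (Fin 3) → EuclideanSpace ℝ (Fin 3)) (R : ℕ → ℝ),
        (∀ n : ℕ, Torus.IsSmooth (u n) ∧ Torus.IsDivFree (u n) ∧ Torus.HasZeroMean (u n) ∧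
          ∫ x, ‖u n x‖ ^ 2 ≤ E ∧ 0 ≤ R n ∧
          ∀ w : UnitAddTorus (Fin 3) → EuclideanSpace ℝ (Fin 3),
            Torus.IsSmooth w → Torus.IsDivFree w → Torus.HasZeroMean w →
            |∫ x, inner ℝ (Torus.convect (u n) (u n) x - f x) (w x)| ≤ R n * Real.sqrt (Torus.gradNormSq w)) →
        Tendsto R atTop (𝓝 0) →
        Tendsto (fun n => R n * Real.sqrt (Torus.gradNormSq (u n))) atTop (𝓝 0) →
        ∃ B : ℝ, ∀ N : ℕ, ∃ n : ℕ, N ≤ n ∧ Torus.gradNormSq (u n) ≤ B) →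
      ∀ u : Torus.energySpace (Fin 3),
        (u : Lp (EuclideanSpace ℝ (Fin 3)) 2 (volume : Measure (UnitAddTorus (Fin 3)))) ∈ Torus.energySpaceV (Fin 3) →
        Torus.IsSteadyWeakSolution 0 f u → E ≤ ‖u‖ ^ 2 := by
  intro f E hf hD u hV hsol
  by_contra hlt
  push Not at hlt
  obtain ⟨v, R, hbad, hR, hRG, hdiv⟩ :=
    stub_dodgerAssembly f E u hf hV hlt (stub_truncationResidual f u hf hV hsol)
  obtain ⟨B, hB⟩ := hD v R hbad hR hRG
  obtain ⟨N, hN⟩ := hdiv B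
  obtain ⟨n, hn, hle⟩ := hB N
  exact absurd hle (not_le.mpr (hN n hn))

/-- **S5 `stub_gpNoOnsagerDodger`** — NO ONSAGER DODGERS FOR THE FRUSTRATED FORCE (OPEN; HARDEST; the ONE
load-bearing floor bet of the line = the card's Łojasiewicz inequality stripped of everything compactness (S3)
and the dodger construction (S4) can do; by S4 it already forbids standing flows of `f_GP` in `V`). At every energy
level `E`: if smooth div-free mean-zero `u_n` with `∫|u_n|² ≤ E` balance `f_GP` by inertia ever better
(residual bounds `R_n → 0` over the crux's test class) with vanishing VIRTUAL DISSIPATION `R_n‖∇u_n‖₂ → 0`,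
then their enstrophies do not diverge (some level `B` is undershot infinitely often). Equivalently: bounded-
energy approximate standing flows of `f_GP` with vanishing virtual work cannot escape to infinite roughness.
This is the steady, ν-free form of the floor: steady states of `NS_ν(f_GP)` have `R‖∇u‖ = ν‖∇u‖² = ε`
exactly, so quiet bounded steady branches ARE Onsager dodgers (or converge to enemy (Q)). Why it might fail /
why it is sharp: mollifying an exact standing flow `v ∈ C^σ` of `f_GP` gives `R(v_δ)‖∇v_δ‖ ≲ δ^{3σ−1}`
(commutator `‖(v⊗v)_δ − v_δ⊗v_δ‖₂ ≲ δ^{2σ}`, `‖∇v_δ‖ ≲ δ^{σ−1}`): Onsager-SUPERcritical (`σ > 1/3`) standing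
flows kill the stub, `σ ≤ 1/3` ones (all stationary convex-integration flows in print are `L^∞`:
doi:10.1137/140957354, arXiv:2405.08390 Thm 1.1(a)) do not. CALIBRATION (planner heuristic, standard Nash-
iteration bookkeeping `δ_q = λ_q^{-2β}`, `λ_{q+1} = λ_q^b`, stationary Nash error
`‖R̊_{q+1}‖ ≲ δ_{q+1}^{1/2}δ_q^{1/2}λ_q/λ_{q+1} ≤ δ_{q+2}`): the scheme closes iff `2βb² − (1+β)b + (1−β) ≤ 0`,
whose discriminant is `(1−3β)²`, i.e. iff `1 ≤ b ≤ (1−β)/(2β)`; the ITERATES are Onsager dodgers iff their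
virtual dissipation `‖R̊_q‖‖∇u_q‖ ≍ λ_q^{1−β−2βb} → 0` iff `b > (1−β)/(2β)` — exactly the excluded side, touching
at bounded non-vanishing virtual dissipation. So convex-integration iterates never refute this stub (for any
`β < 1/3`), only genuinely supercritical standing flows would. No tool proves it today (a Liouville/rigidity
statement for forced steady Euler at the Onsager exponent); first cuts: the `(f_GP, u_n) → 0` identity
(test `w = u_n`), concentration-compactness of bad sequences in `H`, CET commutator lower bounds shell by shell. -/
theorem stub_gpNoOnsagerDodger :
    ∀ (E : ℝ) (u : ℕ → UnitAddTorus (Fin 3) → EuclideanSpace ℝ (Fin 3)) (R : ℕ → ℝ),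
      (∀ n : ℕ, Torus.IsSmooth (u n) ∧ Torus.IsDivFree (u n) ∧ Torus.HasZeroMean (u n) ∧
        ∫ x, ‖u n x‖ ^ 2 ≤ E ∧ 0 ≤ R n ∧
        ∀ w : UnitAddTorus (Fin 3) → EuclideanSpace ℝ (Fin 3),
          Torus.IsSmooth w → Torus.IsDivFree w → Torus.HasZeroMean w →
          |∫ x, inner ℝ (Torus.convect (u n) (u n) x -
              (Torus.stokesMode (Pi.single (2 : Fin 3) (1 : ℤ)) (EuclideanSpace.single (0 : Fin 3) (1 : ℝ)) false x +
                Torus.stokesMode (Pi.single (0 : Fin 3) (1 : ℤ)) (EuclideanSpace.single (1 : Fin 3) (1 : ℝ)) false x +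
                Torus.stokesMode (Pi.single (1 : Fin 3) (1 : ℤ)) (EuclideanSpace.single (2 : Fin 3) (1 : ℝ)) false x :
                EuclideanSpace ℝ (Fin 3))) (w x)| ≤ R n * Real.sqrt (Torus.gradNormSq w)) →
      Tendsto R atTop (𝓝 0) →
      Tendsto (fun n => R n * Real.sqrt (Torus.gradNormSq (u n))) atTop (𝓝 0) →
      ∃ B : ℝ, ∀ N : ℕ, ∃ n : ℕ, N ≤ n ∧ Torus.gradNormSq (u n) ≤ B := by
  sorry

/-- **S6 `stub_gpSteadyCeiling`** — THE CEILING HALF OF THE CRUX AT `f_GP` (OPEN; held, NOT this line's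
mechanism — shared with the ceiling lines of this crux and implying `FrustratedForces.GPSteadySubGrashof`,
stmt-2978, via Temam regularity `Torus.Temam1979_steadyWeakSolution_smooth_holds`). Some energy level `E` and
`ν₁ > 0` such that below `ν₁` every smooth div-free mean-zero steady weak state of `NS_ν(f_GP)` has
`∫|u|² ≤ E`. Why it might fail: a fat steady branch — near-laminar `E ≍ ν⁻²` (excluded at leading order since
`f_GP` is NOT Euler-steady, unlike the `−ΔU`-of-Euler class of Disproof `not_body_neg_laplacian_of_euler`,
but a resonant `H¹` skeleton `U` with `(f_GP,U) ≥ 4π²‖U‖²` would revive it: `FrustratedForces.LaminarLimitCompactness`),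
or a WARM critical-layer branch `E ≍ ν^{-2/3}` on an invisible oblique shear skeleton (obstruction note BN1,
formal, every band-limited force). Evidence so far: kit j005517 (symmetric steady branch of `f_GP`,
`ν: 2 → 0.04`: `E: 0.37 → 4.98`, local exponent `−0.16`; inconclusive), j007219 queued. -/
theorem stub_gpSteadyCeiling :
    ∃ E ν₁ : ℝ, 0 < ν₁ ∧ ∀ ν : ℝ, 0 < ν → ν < ν₁ →
      ∀ u : UnitAddTorus (Fin 3) → EuclideanSpace ℝ (Fin 3),
        Torus.IsSmooth u → Torus.IsDivFree u → Torus.HasZeroMean u →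
        (∀ w : UnitAddTorus (Fin 3) → EuclideanSpace ℝ (Fin 3),
          Torus.IsSmooth w → Torus.IsDivFree w → Torus.HasZeroMean w →
          ∫ x, inner ℝ (ν • Torus.laplacian u x - Torus.convect u u x +
              (Torus.stokesMode (Pi.single (2 : Fin 3) (1 : ℤ)) (EuclideanSpace.single (0 : Fin 3) (1 : ℝ)) false x +
                Torus.stokesMode (Pi.single (0 : Fin 3) (1 : ℤ)) (EuclideanSpace.single (1 : Fin 3) (1 : ℝ)) false x +
                Torus.stokesMode (Pi.single (1 : Fin 3) (1 : ℤ)) (EuclideanSpace.single (2 : Fin 3) (1 : ℝ)) false x :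
                EuclideanSpace ℝ (Fin 3))) (w x) = 0) →
        ∫ x, ‖u x‖ ^ 2 ≤ E := by
  sorry

/-! ## Vocabulary of the line (definitional abbreviations of the blocks above; documentation + sanity lemmas) -/

/-- Local notation: real vector fields on `T³`. -/
local notation "Vec3" => (UnitAddTorus (Fin 3)) → (EuclideanSpace ℝ (Fin 3))

/-- The Galloway–Proctor / frustrated force `f_GP = (sin 2πx₂, sin 2πx₀, sin 2πx₁)` (notation; expands to
the inline Stokes-mode sum used in the stubs and in route `FrustratedForces`). -/
local notation "fGP" => (fun x : UnitAddTorus (Fin 3) =>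
  (Torus.stokesMode (Pi.single (2 : Fin 3) (1 : ℤ)) (EuclideanSpace.single (0 : Fin 3) (1 : ℝ)) false x +
    Torus.stokesMode (Pi.single (0 : Fin 3) (1 : ℤ)) (EuclideanSpace.single (1 : Fin 3) (1 : ℝ)) false x +
    Torus.stokesMode (Pi.single (1 : Fin 3) (1 : ℤ)) (EuclideanSpace.single (2 : Fin 3) (1 : ℝ)) false x :
    EuclideanSpace ℝ (Fin 3)))

/-- Admissible fields (the crux's class for `f`, `u` and the tests `w`): smooth, divergence free, mean zero. -/
def IsAdmissible (u : Vec3) : Prop :=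
  Torus.IsSmooth u ∧ Torus.IsDivFree u ∧ Torus.HasZeroMean u

/-- The crux's steady weak form of `NS_ν(f)` at a smooth `u` (verbatim the hypothesis block of the crux). -/
def IsCruxSteady (ν : ℝ) (f u : Vec3) : Prop :=
  ∀ w : Vec3, Torus.IsSmooth w → Torus.IsDivFree w → Torus.HasZeroMean w →
    ∫ x, inner ℝ (ν • Torus.laplacian u x - Torus.convect u u x + f x) (w x) = 0

/-- `R` bounds the Euler/Lamb residual functional `w ↦ ∫⟪(u·∇)u − f, w⟫` of `u` in the dual norm over the
crux's test class (`‖∇w‖₂ = √(gradNormSq w)`); the least such `R` is `‖P(u·∇)u − Pf‖_{Ḣ⁻¹}`. -/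
def IsResidualBound (f u : Vec3) (R : ℝ) : Prop :=
  ∀ w : Vec3, Torus.IsSmooth w → Torus.IsDivFree w → Torus.HasZeroMean w →
    |∫ x, inner ℝ (Torus.convect u u x - f x) (w x)| ≤ R * Real.sqrt (Torus.gradNormSq w)

/-- **Lamb rigidity with a residual cap** (the card's `RigidAt f E c 1`, rung `g = 1`, sharpened by the
triage): admissible near-solutions (`R ≤ δ₀`) of the steady forced Euler equation `P(u·∇)u = Pf` inside
the energy ball `∫|u|² ≤ E` are rough at rate `1/R`: `c ≤ R · ‖∇u‖₂`. -/
def RigidAt (f : Vec3) (E c δ₀ : ℝ) : Prop :=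
  ∀ u : Vec3, Torus.IsSmooth u → Torus.IsDivFree u → Torus.HasZeroMean u → ∫ x, ‖u x‖ ^ 2 ≤ E →
    ∀ R : ℝ, 0 ≤ R → IsResidualBound f u R → R ≤ δ₀ → c ≤ R * Real.sqrt (Torus.gradNormSq u)

/-- Enemy (Q) excluded at level `E`: no finite-enstrophy weak steady Euler state of `f` in the closed `E`-ball. -/
def NoQuietEulerPointV (f : Vec3) (E : ℝ) : Prop :=
  ∀ u : Torus.energySpace (Fin 3),
    (u : Lp (EuclideanSpace ℝ (Fin 3)) 2 (volume : Measure (UnitAddTorus (Fin 3)))) ∈ Torus.energySpaceV (Fin 3) →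
    Torus.IsSteadyWeakSolution 0 f u → E < ‖u‖ ^ 2

/-- A bad sequence at level `E`: admissible, energy `≤ E`, residual bounds `R_n → 0`, virtual dissipation
`R_n‖∇u_n‖ → 0` (exactly what the negation of `∃ c δ₀ > 0, RigidAt f E c δ₀` produces). -/
def IsBadSeq (f : Vec3) (E : ℝ) (u : ℕ → Vec3) (R : ℕ → ℝ) : Prop :=
  (∀ n : ℕ, Torus.IsSmooth (u n) ∧ Torus.IsDivFree (u n) ∧ Torus.HasZeroMean (u n) ∧
      ∫ x, ‖u n x‖ ^ 2 ≤ E ∧ 0 ≤ R n ∧ IsResidualBound f (u n) (R n)) ∧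
    Tendsto R atTop (𝓝 0) ∧ Tendsto (fun n => R n * Real.sqrt (Torus.gradNormSq (u n))) atTop (𝓝 0)

/-- Enemy (D) excluded at level `E`: bad sequences have non-divergent enstrophy. -/
def NoOnsagerDodger (f : Vec3) (E : ℝ) : Prop :=
  ∀ (u : ℕ → Vec3) (R : ℕ → ℝ), IsBadSeq f E u R → ∃ B : ℝ, ∀ N : ℕ, ∃ n : ℕ, N ≤ n ∧ Torus.gradNormSq (u n) ≤ B

/-- The steady energy ceiling of `f` below `ν₁` at level `E` (the CEILING conjunct of the crux at `f`). -/
def SteadyCeilingAt (f : Vec3) (E ν₁ : ℝ) : Prop :=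
  ∀ ν : ℝ, 0 < ν → ν < ν₁ → ∀ u : Vec3, Torus.IsSmooth u → Torus.IsDivFree u → Torus.HasZeroMean u →
    IsCruxSteady ν f u → ∫ x, ‖u x‖ ^ 2 ≤ E

/-! ## Folded forms of the stubs (bridged by `Iff.rfl`) -/

theorem residualTransfer {ν E c δ₀ : ℝ} {f : Vec3} (hν : 0 < ν) (hδ₀ : 0 < δ₀) (hf : Torus.IsSmooth f)
    (hR : RigidAt f E c δ₀) {u : Vec3} (hus : Torus.IsSmooth u) (hud : Torus.IsDivFree u)
    (huz : Torus.HasZeroMean u) (hst : IsCruxSteady ν f u) (hE : ∫ x, ‖u x‖ ^ 2 ≤ E) :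
    min c (δ₀ ^ 2 / ν) ≤ ν * Torus.gradNormSq u :=
  stub_residualTransfer ν E c δ₀ f hν hδ₀ hf hR u hus hud huz hst hE

theorem rigidAt_of_noEnemies {f : Vec3} {E : ℝ} (hf : Torus.IsSmooth f) (hQ : NoQuietEulerPointV f E)
    (hD : NoOnsagerDodger f E) : ∃ c δ₀ : ℝ, 0 < c ∧ 0 < δ₀ ∧ RigidAt f E c δ₀ :=
  stub_compactnessSplit f E hf hQ (fun u R hseq hR hRD => hD u R ⟨hseq, hR, hRD⟩)

theorem gp_noOnsagerDodger (E : ℝ) : NoOnsagerDodger fGP E :=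
  fun u R h => stub_gpNoOnsagerDodger E u R h.1 h.2.1 h.2.2

/-- S4 folded: no Onsager dodgers at level `E` ⟹ standing flows in `V` have energy `≥ E`. -/
theorem le_energy_of_quietPoint {f : Vec3} {E : ℝ} (hf : Torus.IsSmooth f) (hD : NoOnsagerDodger f E)
    (u : Torus.energySpace (Fin 3))
    (hV : (u : Lp (EuclideanSpace ℝ (Fin 3)) 2 (volume : Measure (UnitAddTorus (Fin 3)))) ∈ Torus.energySpaceV (Fin 3))
    (hsol : Torus.IsSteadyWeakSolution 0 f u) : E ≤ ‖u‖ ^ 2 :=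
  dodgerOfQuietPoint f E hf (fun v R hseq hR hRD => hD v R ⟨hseq, hR, hRD⟩) u hV hsol

/-- Enemy (Q) excluded for `f_GP` at every level, from S4 + S5 (applied one level up: `E + 1 ≤ ‖u‖²`). -/
theorem gp_noQuietEulerPointV (hf : Torus.IsSmooth fGP) (E : ℝ) : NoQuietEulerPointV fGP E :=
  fun u hV hsol => by
    have h := le_energy_of_quietPoint (E := E + 1) hf (gp_noOnsagerDodger (E + 1)) u hV hsol
    linarith

/-- **COROLLARY: `f_GP` has no standing flow of finite enstrophy** (the former stand-alone bet, now a
consequence of S4 + S5): no `u ∈ V` is a weak steady Euler state of `f_GP`. Restricted to smooth `u` this is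
the `∀ v` clause of crux #6 `SmoothEulerCoerciveForce` with witness `f_GP`. -/
theorem gp_noQuietEulerPoint (hf : Torus.IsSmooth fGP) (u : Torus.energySpace (Fin 3))
    (hV : (u : Lp (EuclideanSpace ℝ (Fin 3)) 2 (volume : Measure (UnitAddTorus (Fin 3)))) ∈ Torus.energySpaceV (Fin 3)) :
    ¬ Torus.IsSteadyWeakSolution 0 fGP u := fun hsol => by
  have h := le_energy_of_quietPoint (E := ‖u‖ ^ 2 + 1) hf (gp_noOnsagerDodger (‖u‖ ^ 2 + 1)) u hV hsol
  linarith

theorem gp_steadyCeiling : ∃ E ν₁ : ℝ, 0 < ν₁ ∧ SteadyCeilingAt fGP E ν₁ :=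
  stub_gpSteadyCeiling

/-! ## Sanity (sorry-free): the stubs are not vacuous in the wrong direction -/

/-- A smooth quiet Euler point of energy `≤ E` kills rigidity at level `E` for every `c > 0`, `δ₀ ≥ 0`
(the residual bound `R = 0` is admissible there) — so enemy (Q) genuinely has to be excluded, and `RigidAt`
cannot be had for a designer force `f = P(v·∇)v` with `∫|v|² ≤ E`. -/
theorem not_rigidAt_of_quietPoint {f v : Vec3} {E c δ₀ : ℝ} (hc : 0 < c) (hδ₀ : 0 ≤ δ₀)
    (hvs : Torus.IsSmooth v) (hvd : Torus.IsDivFree v) (hvz : Torus.HasZeroMean v)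
    (hvE : ∫ x, ‖v x‖ ^ 2 ≤ E)
    (hquiet : ∀ w : Vec3, Torus.IsSmooth w → Torus.IsDivFree w → Torus.HasZeroMean w →
      ∫ x, inner ℝ (Torus.convect v v x - f x) (w x) = 0) :
    ¬ RigidAt f E c δ₀ := by
  intro hR
  have h0 : IsResidualBound f v 0 := fun w hws hwd hwz => by
    rw [hquiet w hws hwd hwz, abs_zero, zero_mul]
  have := hR v hvs hvd hvz hvE 0 le_rfl h0 hδ₀
  rw [zero_mul] at this
  exact absurd this (not_le.mpr hc)

/-- Monotonicity of rigidity in the constants (smaller `c`, smaller cap `δ₀`, smaller ball `E`). -/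
theorem RigidAt.mono {f : Vec3} {E E' c c' δ₀ δ₀' : ℝ} (h : RigidAt f E c δ₀) (hE : E' ≤ E) (hc : c' ≤ c)
    (hδ : δ₀' ≤ δ₀) : RigidAt f E' c' δ₀' :=
  fun u hus hud huz huE R hR0 hRb hRδ => hc.trans (h u hus hud huz (huE.trans hE) R hR0 hRb (hRδ.trans hδ))

/-! ## The composition: the crux BY NAME from S1–S6 (kernel-checked, no sorry outside the stubs) -/

/-- **`SteadyStatesLoudBounded` from the six stubs.** Witness force `f_GP`; `E, ν₁` from the ceiling S6;
`(c, δ₀)` from the compactness split S3 fed with (Q) (= S4 + S5 at level `E+1`) and S5 at `E`; `ν₀ := min ν₁ 1`,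
`ε₀ := min c (δ₀²)`; for `ν ∈ (0, ν₀)` a steady state has `∫|u|² ≤ E` (S6) and then
`ν·gradNormSq u ≥ min c (δ₀²/ν) ≥ min c (δ₀²)` (S2, using `ν < 1`). -/
theorem SteadyStatesLoudBounded_of : SteadyStatesLoudBounded := by
  obtain ⟨hfs, hfd, hfz⟩ := stub_gpAdmissible
  obtain ⟨E, ν₁, hν₁, hceil⟩ := gp_steadyCeiling
  obtain ⟨c, δ₀, hc, hδ₀, hrig⟩ :=
    rigidAt_of_noEnemies (E := E) hfs (gp_noQuietEulerPointV hfs E) (gp_noOnsagerDodger E)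
  refine ⟨fGP, hfs, hfd, hfz, min c (δ₀ ^ 2), E, min ν₁ 1, lt_min hc (pow_pos hδ₀ 2),
    lt_min hν₁ one_pos, ?_⟩
  intro ν hν hνlt u hus hud huz hsteady
  have hν₁' : ν < ν₁ := lt_of_lt_of_le hνlt (min_le_left _ _)
  have hν1 : ν < 1 := lt_of_lt_of_le hνlt (min_le_right _ _)
  have hE : ∫ x, ‖u x‖ ^ 2 ≤ E := hceil ν hν hν₁' u hus hud huz hsteady
  refine ⟨?_, hE⟩
  have hfloor : min c (δ₀ ^ 2 / ν) ≤ ν * Torus.gradNormSq u :=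
    residualTransfer hν hδ₀ hfs hrig hus hud huz hsteady hE
  have hdiv : δ₀ ^ 2 ≤ δ₀ ^ 2 / ν := by
    rw [le_div_iff₀ hν]
    nlinarith [sq_nonneg δ₀]
  exact (min_le_min le_rfl hdiv).trans hfloor

end Summit.AnomalousDissipation.AnomalousDissipation.Cruxes.SteadyStatesLoudBounded.LojasiewiczLambFloorLadder

end
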